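import Mathlib
import HarnessLib
import Literature.Analysis.FunctionSpaces.SchwartzExchange
import Literature.Analysis.FunctionSpaces.SchwartzParametric
import Literature.MathematicalPhysics.QuantumLattice.SchwartzTranslationCutoff

/-!
# `CurvatureKernelBound` — stub A2 support: a continuous kernel from Fourier decay of `χT`

Support file for crux `stmt-QuantumFields-11687` (`PencilRigidity.CurvatureKernelBound`), line
`sixteen-charts-analytic-kernel`, stub `TensorRegularity` (A2, pure analysis).  The elementary
Paley–Wiener mechanism behind "`WF(u) = ∅` ⇒ `u` is a function": let `T ∈ 𝒮'(V)` on a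
finite-dimensional real inner product space `V`, `χ ∈ 𝒮(V)`, and suppose the values of `T` on the
cut-off plane waves `e_a χ = 𝐞(-⟪a, ·⟫) χ` (the Fourier transform `(χT)^(a)` of the distribution
`χT`) are dominated by an integrable function `b(a)`.  Then `χT` is integration against the
continuous bounded kernel `K = 𝓕⁻¹ (χT)^`, `|K| ≤ ∫ b`:

* `exists_kernel_of_planeWave_bound` / registered sub-goal `FourierDecayKernel`:
  `T(χ F) = ∫ K F` for every `F ∈ 𝒮(V)`.

Proof: `e_a χ = 𝓕((𝓕⁻¹χ)(· − a))` is a continuous family of polynomial seminorm growth in `a`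
(tree: `continuous_compSubConstCLM`, `SchwartzMap.exists_seminorm_clm_compSubConstCLM_le`), and
`χ F = ∫ (𝓕⁻¹F)(a) e_a χ da` pointwise (Fourier inversion), so the tree's exchange theorem
`SchwartzMap.apply_eq_integral_of_forall_apply_eq_integral` gives `T(χF) = ∫ 𝓕⁻¹F · (χT)^`, and the
self-adjointness of `𝓕⁻¹` (`VectorFourier.integral_fourierIntegral_smul_eq_flip`) concludes.
[folklore]
-/

noncomputable section

open scoped SchwartzMap FourierTransform RealInnerProductSpace
open MeasureTheory Filter Set Real
open Literature.MathematicalPhysics.QuantumLattice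

namespace Summit.QuantumFields.YangMills.Theorems.CurvatureKernel

section Fourier

variable {V : Type*} [NormedAddCommGroup V] [InnerProductSpace ℝ V] [FiniteDimensional ℝ V]
  [MeasurableSpace V] [BorelSpace V]

-- adapted from Literature/Analysis/FunctionSpaces/WightmanGNSSpectral.lean (`fourier_compSubConstCLM_apply`)
/-- **Fourier transform of a translate**: `𝓕(χ(· − a))(x) = 𝐞(-⟪a, x⟫) 𝓕χ(x)`. [folklore] -/
theorem fourier_compSubConstCLM_apply (a : V) (χ : 𝓢(V, ℂ)) (x : V) :
    (𝓕 (SchwartzMap.compSubConstCLM ℂ a χ)) x = (𝐞 (-⟪a, x⟫) : ℂ) * (𝓕 χ) x := by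
  rw [SchwartzMap.fourier_coe, SchwartzMap.fourier_coe]
  have h : ⇑(SchwartzMap.compSubConstCLM ℂ a χ) = (χ : V → ℂ) ∘ fun y => y + (-a) := by
    funext y
    simp [SchwartzMap.compSubConstCLM_apply, sub_eq_add_neg]
  rw [h]
  have := congrFun (VectorFourier.fourierIntegral_comp_add_right 𝐞 volume (innerₗ V) (χ : V → ℂ) (-a)) x
  simp only [Circle.smul_def, smul_eq_mul] at this
  have hI : ((innerₗ V) (-a)) x = -⟪a, x⟫ := by
    change ⟪-a, x⟫ = -⟪a, x⟫
    exact inner_neg_left a x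
  rw [hI] at this
  exact this

/-- **The cut-off plane waves are Fourier transforms of translates**: `𝓕((𝓕⁻¹χ)(· − a)) = e_a χ`,
i.e. `𝓕((𝓕⁻¹χ)(· − a))(x) = 𝐞(-⟪a, x⟫) χ(x)`. [folklore] -/
theorem fourier_compSubConstCLM_fourierInv_apply (a : V) (χ : 𝓢(V, ℂ)) (x : V) :
    (𝓕 (SchwartzMap.compSubConstCLM ℂ a (𝓕⁻ χ : 𝓢(V, ℂ)))) x = (𝐞 (-⟪a, x⟫) : ℂ) * χ x := by
  rw [fourier_compSubConstCLM_apply, FourierInvPair.fourier_fourierInv_eq]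

/-- **Self-adjointness of the inverse Fourier transform**: `∫ 𝓕⁻¹F · g = ∫ F · 𝓕⁻¹g` for a Schwartz
`F` and an integrable `g`. [folklore] -/
theorem integral_fourierInv_mul_eq_integral_mul_fourierInv (F : 𝓢(V, ℂ)) {g : V → ℂ} (hg : Integrable g) :
    ∫ a, (𝓕⁻ F : 𝓢(V, ℂ)) a * g a = ∫ x, F x * (𝓕⁻ g) x := by
  have hflip : (-innerₗ V : V →ₗ[ℝ] V →ₗ[ℝ] ℝ).flip = -innerₗ V := by
    ext x y
    change -⟪y, x⟫ = -⟪x, y⟫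
    rw [real_inner_comm]
  have hL : Continuous fun p : V × V => (-innerₗ V : V →ₗ[ℝ] V →ₗ[ℝ] ℝ) p.1 p.2 := continuous_inner.neg
  have hsa := VectorFourier.integral_fourierIntegral_smul_eq_flip (L := -innerₗ V) (μ := volume) (ν := volume)
    (f := (F : V → ℂ)) (g := g) Real.continuous_fourierChar hL F.integrable hg
  rw [hflip] at hsa
  simp only [smul_eq_mul] at hsa
  have hw : ∀ a, (𝓕⁻ F : 𝓢(V, ℂ)) a = VectorFourier.fourierIntegral 𝐞 volume (-innerₗ V) (F : V → ℂ) a := by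
    intro a
    rw [SchwartzMap.fourierInv_coe]
    rfl
  simp_rw [hw]
  exact hsa

/-- **A continuous kernel from Fourier decay of `χT`.** Let `T ∈ 𝒮'(V)`, `χ ∈ 𝒮(V)` and let `b` be
integrable with `‖T ψ‖ ≤ b(a)` for every cut-off plane wave `ψ = 𝐞(-⟪a, ·⟫) χ`.  Then there is a
continuous kernel `K` (namely `𝓕⁻¹` of `a ↦ T(e_a χ)`) with `|K| ≤ ∫ b` and `T(χ F) = ∫ K F` for all
`F ∈ 𝒮(V)`. [folklore] -/
theorem exists_kernel_of_planeWave_bound (T : 𝓢(V, ℂ) →L[ℂ] ℂ) (χ : 𝓢(V, ℂ)) {b : V → ℝ}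
    (hb : Integrable b)
    (hT : ∀ (a : V) (ψ : 𝓢(V, ℂ)), (∀ x, ψ x = (𝐞 (-⟪a, x⟫) : ℂ) * χ x) → ‖T ψ‖ ≤ b a) :
    ∃ K : V → ℂ, Continuous K ∧ (∀ x, ‖K x‖ ≤ ∫ a, b a) ∧ ∀ F : 𝓢(V, ℂ),
      Integrable (fun x => K x * F x) ∧ T (SchwartzMap.smulLeftCLM ℂ (χ : V → ℂ) F) = ∫ x, K x * F x := by
  -- the family of cut-off plane waves `Ψ a = e_a χ`
  set χ₀ : 𝓢(V, ℂ) := 𝓕⁻ χ with hχ₀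
  set FT : 𝓢(V, ℂ) →L[ℂ] 𝓢(V, ℂ) := SchwartzMap.fourierTransformCLM ℂ with hFT
  set Ψ : V → 𝓢(V, ℂ) := fun a => FT (SchwartzMap.compSubConstCLM ℂ a χ₀) with hΨ
  have hΨx : ∀ a x, Ψ a x = (𝐞 (-⟪a, x⟫) : ℂ) * χ x := fun a x => by
    simp only [hΨ, hFT, SchwartzMap.fourierTransformCLM_apply, hχ₀]
    exact fourier_compSubConstCLM_fourierInv_apply a χ x
  have hΨc : Continuous Ψ := FT.continuous.comp (continuous_compSubConstCLM ℂ χ₀)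
  have hgrowth : ∀ k n : ℕ, ∃ (C : ℝ) (N : ℕ), ∀ a : V,
      SchwartzMap.seminorm ℂ k n (Ψ a) ≤ C * (1 + ‖a‖) ^ N := fun k n =>
    SchwartzMap.exists_seminorm_clm_compSubConstCLM_le FT χ₀ (ContinuousLinearMap.id ℝ V) k n
  -- the Fourier transform `g(a) = T(e_a χ)` of `χT`
  set g : V → ℂ := fun a => T (Ψ a) with hg
  have hgc : Continuous g := T.continuous.comp hΨc
  have hgb : ∀ a, ‖g a‖ ≤ b a := fun a => hT a (Ψ a) (hΨx a)
  have hgi : Integrable g := hb.mono' hgc.aestronglyMeasurable (Eventually.of_forall hgb)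
  have hL : Continuous fun p : V × V => (-innerₗ V : V →ₗ[ℝ] V →ₗ[ℝ] ℝ) p.1 p.2 := continuous_inner.neg
  have hKc : Continuous (𝓕⁻ g : V → ℂ) := by
    change Continuous (VectorFourier.fourierIntegral 𝐞 volume (-innerₗ V) g)
    exact VectorFourier.fourierIntegral_continuous Real.continuous_fourierChar hL hgi
  have hKb : ∀ x, ‖(𝓕⁻ g : V → ℂ) x‖ ≤ ∫ a, b a := fun x =>
    calc ‖(𝓕⁻ g : V → ℂ) x‖ ≤ ∫ a, ‖g a‖ :=
          VectorFourier.norm_fourierIntegral_le_integral_norm 𝐞 volume (-innerₗ V) g x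
      _ ≤ ∫ a, b a := integral_mono hgi.norm hb hgb
  refine ⟨𝓕⁻ g, hKc, hKb, fun F => ⟨?_, ?_⟩⟩
  · exact F.integrable.bdd_mul hKc.aestronglyMeasurable (Eventually.of_forall hKb)
  -- the exchange: `T(χ F) = ∫ 𝓕⁻¹F(a) T(e_a χ) da`
  set w : V → ℂ := fun a => (𝓕⁻ F : 𝓢(V, ℂ)) a with hw
  have hK : ∀ x, SchwartzMap.smulLeftCLM ℂ (χ : V → ℂ) F x = ∫ a, w a * Ψ a x := by
    intro x
    rw [SchwartzMap.smulLeftCLM_apply_apply χ.hasTemperateGrowth, smul_eq_mul]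
    have hF : F x = (𝓕 (𝓕⁻ F : 𝓢(V, ℂ))) x := by rw [FourierInvPair.fourier_fourierInv_eq]
    rw [hF, SchwartzMap.fourier_coe, Real.fourier_eq, ← integral_const_mul]
    refine integral_congr_ae (Eventually.of_forall fun a => ?_)
    simp only [hΨx, hw, Circle.smul_def, smul_eq_mul]
    ring
  have hex := SchwartzMap.apply_eq_integral_of_forall_apply_eq_integral T Ψ hΨc hgrowth w
    (𝓕⁻ F : 𝓢(V, ℂ)).continuous (fun N => SchwartzMap.integrable_one_add_norm_pow_mul (𝓕⁻ F : 𝓢(V, ℂ)) N) _ hK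
  -- Fourier self-adjointness
  rw [hex, show (fun a => w a * T (Ψ a)) = fun a => (𝓕⁻ F : 𝓢(V, ℂ)) a * g a from rfl,
    integral_fourierInv_mul_eq_integral_mul_fourierInv F hgi]
  exact integral_congr_ae (Eventually.of_forall fun x => mul_comm _ _)

/-- **Sub-goal `FourierDecayKernel`** (helper for stub `TensorRegularity`): a tempered distribution whose
localisation `χT` has plane-wave values dominated by an integrable function is, after localisation,
integration against a continuous bounded kernel; restatement of `exists_kernel_of_planeWave_bound`. [folklore] -/
theorem FourierDecayKernel : ∀ {V : Type*} [NormedAddCommGroup V] [InnerProductSpace ℝ V] [FiniteDimensional ℝ V] [MeasurableSpace V] [BorelSpace V] (T : SchwartzMap V ℂ →L[ℂ] ℂ) (χ : SchwartzMap V ℂ) (b : V → ℝ), MeasureTheory.Integrable b → (∀ (a : V) (ψ : SchwartzMap V ℂ), (∀ x, ψ x = ((Real.fourierChar (-(inner ℝ a x)) : Circle) : ℂ) * χ x) → ‖T ψ‖ ≤ b a) → ∃ K : V → ℂ, Continuous K ∧ (∀ x, ‖K x‖ ≤ ∫ a, b a) ∧ ∀ F : SchwartzMap V ℂ, MeasureTheory.Integrable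 (fun x => K x * F x) ∧ T (SchwartzMap.smulLeftCLM ℂ (χ : V → ℂ) F) = ∫ x, K x * F x := by
  intro V _ _ _ _ _ T χ b hb hT
  exact exists_kernel_of_planeWave_bound T χ hb hT

end Fourier

end Summit.QuantumFields.YangMills.Theorems.CurvatureKernel
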